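import Summits.Ventures.LatticeQCDFlow.Scoring.ChainLagProductCLT
import Summits.Ventures.LatticeQCDFlow.Exactness.NCMCGeneralSpaceDoeblinPowerDecorrelation

/-!
# The asymptotic covariance MATRIX of the chain's empirical autocovariances: the variance functional
# `a ↦ windowLRVar κ π W (lagProdComb f̄ W a)` is the quadratic form of the Bartlett-type matrix
# `Σ(s,t) = Σ_{k ∈ ℤ} cov_π(f̄(X_0) f̄(X_s), f̄(X_k) f̄(X_{k+t}))`, and it is nonnegative

HONEST FRAMING: exact (Metropolis-corrected) sampling algorithms for lattice gauge theory;
figures of merit are autocorrelation/cost numbers at stated couplings and volumes; no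
continuum-physics claim.

Venture `LatticeQCDFlow` (cell pub-lqcd), sub-topic `Scoring`; FANOUT row 16 (`su2-base`), GEN-9.
NEW WORK of the cell, not a published result; one definition (`chainLagACov`, the matrix); nothing is
cited as a fact (Bartlett's formula for the covariances of sample autocovariances — Bartlett 1946,
Anderson 1971 §8.3 — NAMED ONLY; here with NO Gaussian / linear-process assumption, for a bounded
observable of a chain with a Doeblin power).  MARKOV-CHAIN COUNTERPART of GEN-7's
`BlockFactorBartlett.lagProdACov` / `LagProductCLT.lrVar_inner_lagProdMap` (bilinearity of the long-run
variance of the projected lag-product series).  Ingredients: the summability of the lag-product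
autocovariance series, from the sup-norm decay of the WINDOW CHAIN (`Scoring/SlidingWindowChain`:
Doeblin power `(nHit κ_W (m+W)) ≥ ε ν_W`; row 13's `abs_iterate_kop_sub_integral_le_of_nHit`), and
nonnegativity of the window chain's Green–Kubo variance through row 13's Poisson equation
(`NCMCGeneralSpaceDoeblinPowerPoisson`: `σ² = ∫ h² − ∫ (κ_W h)² ≥ 0` by Jensen).

## Content (`κ` Markov, `π` invariant, `(nHit κ m)(z,·) ≥ ε ν` for all `z`, `ε ≠ 0`, `0 < m`; `g`
## bounded measurable — in the applications `g = f̄ = f − ∫ f dπ`; `Y_k = (X_k, …, X_{k+W})`;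
## `φ_s(Y_k) = g(X_k) g(X_{k+s})`, `C(s) = autocov κ π g s`, `φ̄_s = φ_s − C(s)`)

* `chainLagACov κ π g W s t` [ours] —
  `Σ(s,t) = E_π[φ̄_s(Y_0) φ̄_t(Y_0)] + Σ_{k≥0} (E_π[φ̄_s(Y_0) φ̄_t(Y_{k+1})] + E_π[φ̄_t(Y_0) φ̄_s(Y_{k+1})])`
  (symmetric by construction: `chainLagACov_comm`);
* **`summable_chainLagCov_of_nHit`** — `k ↦ E_π[φ̄_s(Y_0) φ̄_t(Y_{k+1})]` is summable (geometric envelope);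
* **`quadForm_chainLagACov_of_nHit`** — BILINEARITY:
  `Σ_s Σ_t a_s a_t Σ(s,t) = windowLRVar κ π W (lagProdComb g W a)` for every `a`;
* **`windowLRVar_nonneg_of_nHit`** — `0 ≤ windowLRVar κ π W ψ` for every bounded measurable window
  functional `ψ`; hence `quadForm_chainLagACov_nonneg_of_nHit` (`Σ` is positive semidefinite as a
  quadratic form).

Next file: `Matrix.of Σ` is `PosSemidef`, `N(0, Σ)` realises the limit `Z` of `ChainLagProductCLT` /
`ChainTauIntWindowCLT` (non-vacuity).  NOT CLAIMED: `Σ` positive definite (false in general); closed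
forms of `Σ` for concrete samplers; the Wick/Gaussian reduction to Bartlett's kernel (GEN-6/7 files
cover that model).
-/

noncomputable section

open MeasureTheory ProbabilityTheory Filter Finset Preorder WithLp
open scoped ENNReal Topology RealInnerProductSpace
open Summit.Ventures.LatticeQCDFlow.Exactness Summit.Ventures.LatticeQCDFlow.Exactness.GeneralNCMC

namespace Summit.Ventures.LatticeQCDFlow.Scoring

variable {S : Type*} [MeasurableSpace S]

/-! ## The matrix -/

section Matrix

/-- **The asymptotic covariance matrix of the empirical autocovariances of `g` along the chain** at lags
`s, t ≤ W`: with `φ̄_s(Y_k) = g(X_k) g(X_{k+s}) − autocov κ π g s` read on the `k`-th window,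
`Σ(s,t) = E_π[φ̄_s(Y_0) φ̄_t(Y_0)] + Σ_{k≥0} (E_π[φ̄_s(Y_0) φ̄_t(Y_{k+1})] + E_π[φ̄_t(Y_0) φ̄_s(Y_{k+1})])`
— Bartlett's bilateral sum `Σ_{k∈ℤ} cov_π(φ_s(Y_0), φ_t(Y_k))` folded onto `k ≥ 0`. [ours] -/
def chainLagACov (κ : Kernel S S) [IsMarkovKernel κ] (π : Measure S) (g : S → ℝ) (W : ℕ)
    (s t : Fin (W + 1)) : ℝ :=
  (∫ x, (g (windowPath W x 0 0) * g (windowPath W x 0 s) - autocov κ π g s)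
      * (g (windowPath W x 0 0) * g (windowPath W x 0 t) - autocov κ π g t)
    ∂(Kernel.trajMeasure (X := fun _ : ℕ => S) π
      (fun n : ℕ => κ.comap (fun hh : (i : ↥(Finset.Iic n)) → S => hh ⟨n, Finset.mem_Iic.2 le_rfl⟩)
        (measurable_pi_apply _))))
  + ∑' k, ((∫ x, (g (windowPath W x 0 0) * g (windowPath W x 0 s) - autocov κ π g s)
      * (g (windowPath W x (k + 1) 0) * g (windowPath W x (k + 1) t) - autocov κ π g t)
    ∂(Kernel.trajMeasure (X := fun _ : ℕ => S) π
      (fun n : ℕ => κ.comap (fun hh : (i : ↥(Finset.Iic n)) → S => hh ⟨n, Finset.mem_Iic.2 le_rfl⟩)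
        (measurable_pi_apply _))))
    + (∫ x, (g (windowPath W x 0 0) * g (windowPath W x 0 t) - autocov κ π g t)
      * (g (windowPath W x (k + 1) 0) * g (windowPath W x (k + 1) s) - autocov κ π g s)
    ∂(Kernel.trajMeasure (X := fun _ : ℕ => S) π
      (fun n : ℕ => κ.comap (fun hh : (i : ↥(Finset.Iic n)) → S => hh ⟨n, Finset.mem_Iic.2 le_rfl⟩)
        (measurable_pi_apply _)))))

/-- `Σ` is symmetric. -/
theorem chainLagACov_comm (κ : Kernel S S) [IsMarkovKernel κ] (π : Measure S) (g : S → ℝ) (W : ℕ)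
    (s t : Fin (W + 1)) : chainLagACov κ π g W s t = chainLagACov κ π g W t s := by
  unfold chainLagACov
  congr 1
  · exact integral_congr_ae (ae_of_all _ fun x => mul_comm _ _)
  · exact tsum_congr fun k => add_comm _ _

end Matrix

section Doeblin

variable (κ : Kernel S S) [IsMarkovKernel κ] (W : ℕ) {π : Measure S} [IsProbabilityMeasure π]
  {ν : Measure S} [IsProbabilityMeasure ν] {ε : ℝ≥0∞} {m : ℕ}

/-! ## Summability of the lag-product autocovariance series -/

/-- **Decay of two-window covariances under a Doeblin power**: for bounded measurable window
functionals `G`, `H` with `E_π H(Y_0) = 0`,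
`|E_π[G(Y_0) H(Y_k)]| ≤ C_G · 2 C_H · (1 − ε)^{⌊k/(m+W)⌋}`. -/
theorem abs_integral_window_mul_le_of_nHit (hπ : Kernel.Invariant κ π)
    (hmin : ∀ z, ε • ν ≤ nHit κ m z)
    {G H : (Fin (W + 1) → S) → ℝ} (hG : Measurable G) {CG : ℝ} (hCG : ∀ v, |G v| ≤ CG)
    (hH : Measurable H) {CH : ℝ} (hCH : ∀ v, |H v| ≤ CH)
    (hH0 : ∫ x, H (windowPath W x 0) ∂(Kernel.trajMeasure (X := fun _ : ℕ => S) π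
        (fun n : ℕ => κ.comap (fun hh : (i : ↥(Finset.Iic n)) → S => hh ⟨n, Finset.mem_Iic.2 le_rfl⟩)
          (measurable_pi_apply _))) = 0) (k : ℕ) :
    |∫ x, G (windowPath W x 0) * H (windowPath W x k) ∂(Kernel.trajMeasure (X := fun _ : ℕ => S) π
        (fun n : ℕ => κ.comap (fun hh : (i : ↥(Finset.Iic n)) → S => hh ⟨n, Finset.mem_Iic.2 le_rfl⟩)
          (measurable_pi_apply _)))|
      ≤ CG * (2 * CH * (1 - ε.toReal) ^ (k / (m + W))) := by
  set Pπ := Kernel.trajMeasure (X := fun _ : ℕ => S) π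
    (fun n : ℕ => κ.comap (fun hh : (i : ↥(Finset.Iic n)) → S => hh ⟨n, Finset.mem_Iic.2 le_rfl⟩)
      (measurable_pi_apply _)) with hPπ
  haveI hπWp : IsProbabilityMeasure (Pπ.map (fun x : ℕ → S => windowPath W x 0)) :=
    Measure.isProbabilityMeasure_map (measurable_windowPath_at 0).aemeasurable
  haveI hνWp : IsProbabilityMeasure ((Kernel.trajMeasure (X := fun _ : ℕ => S) ν
      (fun n : ℕ => κ.comap (fun hh : (i : ↥(Finset.Iic n)) → S => hh ⟨n, Finset.mem_Iic.2 le_rfl⟩)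
        (measurable_pi_apply _))).map (fun x : ℕ → S => windowPath W x 0)) :=
    Measure.isProbabilityMeasure_map (measurable_windowPath_at 0).aemeasurable
  haveI := isMarkovKernel_nHit κ m
  haveI : Nonempty S := nonempty_of_isProbabilityMeasure π
  have hε1 : ε ≤ 1 := eps_le_one_of_minorised hmin
  have hπW : Kernel.Invariant (windowKernel κ W) (Pπ.map (fun x : ℕ → S => windowPath W x 0)) := by
    rw [hPπ]; exact invariant_windowKernel κ W hπ
  have hminWS : ∀ y {B : Set (Fin (W + 1) → S)}, MeasurableSet B →
      ε * ((Kernel.trajMeasure (X := fun _ : ℕ => S) ν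
        (fun n : ℕ => κ.comap (fun hh : (i : ↥(Finset.Iic n)) → S => hh ⟨n, Finset.mem_Iic.2 le_rfl⟩)
          (measurable_pi_apply _))).map (fun x : ℕ → S => windowPath W x 0)) B
        ≤ nHit (windowKernel κ W) (m + W) y B :=
    fun y _ hB => minorised_setwise (windowKernel_minorised_of_nHit κ W hmin) y hB
  have hH0' : ∫ y, H y ∂(Pπ.map (fun x : ℕ → S => windowPath W x 0)) = 0 := by
    rw [hPπ, integral_windowLaw κ W hH]; exact hH0
  -- `E_π[G(Y_0) H(Y_k)] = ∫ G · (κ_W)^k H dπ_W`, and `|(κ_W)^k H| ≤ 2 C_H (1−ε)^{⌊k/(m+W)⌋}`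
  rw [hPπ, ← integral_iterate_kop_windowKernel κ W hπ hG hCG hH hCH k, ← hPπ]
  have hbound : ∀ y, |G y * (kop (windowKernel κ W))^[k] H y| ≤ CG * (2 * CH * (1 - ε.toReal) ^ (k / (m + W))) :=
    fun y => by
      rw [abs_mul]
      have h2 := abs_iterate_kop_sub_integral_le_of_nHit hminWS hε1 hπW hH hCH k y
      rw [hH0', sub_zero] at h2
      exact mul_le_mul (hCG y) h2 (abs_nonneg _) ((abs_nonneg _).trans (hCG y))
  have h := norm_integral_le_of_norm_le_const (μ := Pπ.map (fun x : ℕ → S => windowPath W x 0))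
    (f := fun y => G y * (kop (windowKernel κ W))^[k] H y)
    (C := CG * (2 * CH * (1 - ε.toReal) ^ (k / (m + W))))
    (Eventually.of_forall fun y => by rw [Real.norm_eq_abs]; exact hbound y)
  rwa [Real.norm_eq_abs, probReal_univ, mul_one] at h

/-- The centring constant of a lag product under `P_π` is the autocovariance:
`E_π[g(X_k) g(X_{k+s})]` read on the window `Y_0` is `autocov κ π g s`. -/
theorem integral_lagProd_window_zero (hπ : Kernel.Invariant κ π) {g : S → ℝ} (hg : Measurable g)
    {C : ℝ} (hC : ∀ z, |g z| ≤ C) (s : Fin (W + 1)) :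
    ∫ x, g (windowPath W x 0 0) * g (windowPath W x 0 s) ∂(Kernel.trajMeasure (X := fun _ : ℕ => S) π
        (fun n : ℕ => κ.comap (fun hh : (i : ↥(Finset.Iic n)) → S => hh ⟨n, Finset.mem_Iic.2 le_rfl⟩)
          (measurable_pi_apply _))) = autocov κ π g s := by
  simp only [windowPath_apply, Nat.add_zero, Fin.val_zero]
  exact chain_autocov hπ hg hC 0 s

/-- **Summability of the lag-product autocovariance series**:
`k ↦ E_π[φ̄_s(Y_0) φ̄_t(Y_{k+1})]` is summable under a Doeblin power (`0 < m`). -/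
theorem summable_chainLagCov_of_nHit (hπ : Kernel.Invariant κ π) (hε : ε ≠ 0)
    (hmin : ∀ z, ε • ν ≤ nHit κ m z) (hm : 0 < m) {g : S → ℝ} (hg : Measurable g) {C : ℝ}
    (hC : ∀ z, |g z| ≤ C) (s t : Fin (W + 1)) :
    Summable fun k : ℕ => ∫ x, (g (windowPath W x 0 0) * g (windowPath W x 0 s) - autocov κ π g s)
      * (g (windowPath W x (k + 1) 0) * g (windowPath W x (k + 1) t) - autocov κ π g t)
      ∂(Kernel.trajMeasure (X := fun _ : ℕ => S) π
        (fun n : ℕ => κ.comap (fun hh : (i : ↥(Finset.Iic n)) → S => hh ⟨n, Finset.mem_Iic.2 le_rfl⟩)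
          (measurable_pi_apply _))) := by
  haveI := isMarkovKernel_nHit κ m
  haveI : Nonempty S := nonempty_of_isProbabilityMeasure π
  have hε1 : ε ≤ 1 := eps_le_one_of_minorised hmin
  have hεtop : ε ≠ ⊤ := ne_top_of_le_ne_top ENNReal.one_ne_top hε1
  have hεpos : 0 < ε.toReal := ENNReal.toReal_pos hε hεtop
  have hr0 : 0 ≤ 1 - ε.toReal :=
    sub_nonneg.2 (ENNReal.toReal_le_of_le_ofReal zero_le_one (by simpa using hε1))
  have hr1 : 1 - ε.toReal < 1 := sub_lt_self _ hεpos
  -- the two centred lag-product functionals on windows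
  have hGm : ∀ u : Fin (W + 1), Measurable fun y : Fin (W + 1) → S => g (y 0) * g (y u) - autocov κ π g u :=
    fun u => ((hg.comp (measurable_pi_apply 0)).mul (hg.comp (measurable_pi_apply u))).sub measurable_const
  have hGb : ∀ (u : Fin (W + 1)) (y : Fin (W + 1) → S),
      |g (y 0) * g (y u) - autocov κ π g u| ≤ C * C + |autocov κ π g u| := fun u y => by
    refine (abs_sub _ _).trans (add_le_add ?_ le_rfl)
    rw [abs_mul]
    exact mul_le_mul (hC _) (hC _) (abs_nonneg _) ((abs_nonneg _).trans (hC (y 0)))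
  have hH0 : ∫ x, (fun y : Fin (W + 1) → S => g (y 0) * g (y t) - autocov κ π g t) (windowPath W x 0)
      ∂(Kernel.trajMeasure (X := fun _ : ℕ => S) π
        (fun n : ℕ => κ.comap (fun hh : (i : ↥(Finset.Iic n)) → S => hh ⟨n, Finset.mem_Iic.2 le_rfl⟩)
          (measurable_pi_apply _))) = 0 := by
    have hint : Integrable (fun x : ℕ → S => g (windowPath W x 0 0) * g (windowPath W x 0 t))
        (Kernel.trajMeasure (X := fun _ : ℕ => S) π
          (fun n : ℕ => κ.comap (fun hh : (i : ↥(Finset.Iic n)) → S => hh ⟨n, Finset.mem_Iic.2 le_rfl⟩)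
            (measurable_pi_apply _))) :=
      integrable_of_bounded _ ((hg.comp ((measurable_pi_apply 0).comp (measurable_windowPath_at 0))).mul
        (hg.comp ((measurable_pi_apply t).comp (measurable_windowPath_at 0)))) (C := C * C) fun x => by
          rw [abs_mul]
          exact mul_le_mul (hC _) (hC _) (abs_nonneg _) ((abs_nonneg _).trans (hC (windowPath W x 0 0)))
    simp only
    rw [integral_sub hint (integrable_const _), integral_const, probReal_univ, one_smul,
      integral_lagProd_window_zero κ W hπ hg hC t, sub_self]
  have hbound := fun k => abs_integral_window_mul_le_of_nHit κ W hπ hmin (hGm s) (hGb s) (hGm t) (hGb t) hH0 (k + 1)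
  refine Summable.of_norm_bounded (g := fun k : ℕ =>
      (C * C + |autocov κ π g s|) * (2 * (C * C + |autocov κ π g t|) * (1 - ε.toReal) ^ (k / (m + W)))) ?_
    fun k => ?_
  · exact ((summable_pow_div (by omega) hr0 hr1).mul_left _).mul_left _
  · rw [Real.norm_eq_abs]
    refine (hbound k).trans (mul_le_mul_of_nonneg_left (mul_le_mul_of_nonneg_left
      (pow_le_pow_of_le_one hr0 hr1.le (Nat.div_le_div_right (Nat.le_succ k))) ?_) ?_)
    · exact mul_nonneg zero_le_two ((abs_nonneg _).trans (hGb t (fun _ => Classical.choice ‹Nonempty S›)))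
    · exact (abs_nonneg _).trans (hGb s (fun _ => Classical.choice ‹Nonempty S›))

/-! ## The variance functional is the quadratic form of `Σ` -/

/-- **BILINEARITY: `Σ_s Σ_t a_s a_t Σ(s,t) = windowLRVar κ π W (lagProdComb g W a)`** — the long-run
variance of the projected lag-product series `Σ_t a_t g(X_i) g(X_{i+t})` is the quadratic form of the
asymptotic covariance matrix (finite sums exchanged with the `k`-series by summability). -/
theorem quadForm_chainLagACov_of_nHit (hπ : Kernel.Invariant κ π) (hε : ε ≠ 0)
    (hmin : ∀ z, ε • ν ≤ nHit κ m z) (hm : 0 < m) {g : S → ℝ} (hg : Measurable g) {C : ℝ}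
    (hC : ∀ z, |g z| ≤ C) (a : EuclideanSpace ℝ (Fin (W + 1))) :
    ∑ s : Fin (W + 1), ∑ t : Fin (W + 1), a s * a t * chainLagACov κ π g W s t
      = windowLRVar κ π W (lagProdComb g W a) := by
  set Pπ := Kernel.trajMeasure (X := fun _ : ℕ => S) π
    (fun n : ℕ => κ.comap (fun hh : (i : ↥(Finset.Iic n)) → S => hh ⟨n, Finset.mem_Iic.2 le_rfl⟩)
      (measurable_pi_apply _)) with hPπ
  -- the centred lag products read on the `k`-th window
  set Φ : Fin (W + 1) → ℕ → (ℕ → S) → ℝ :=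
    fun u k x => g (windowPath W x k 0) * g (windowPath W x k u) - autocov κ π g u with hΦ
  have hΦm : ∀ u k, Measurable (Φ u k) := fun u k =>
    ((hg.comp ((measurable_pi_apply 0).comp (measurable_windowPath_at k))).mul
      (hg.comp ((measurable_pi_apply u).comp (measurable_windowPath_at k)))).sub measurable_const
  have hΦb : ∀ u k x, |Φ u k x| ≤ C * C + |autocov κ π g u| := fun u k x => by
    refine (abs_sub _ _).trans (add_le_add ?_ le_rfl)
    rw [abs_mul]
    exact mul_le_mul (hC _) (hC _) (abs_nonneg _) ((abs_nonneg _).trans (hC (windowPath W x k 0)))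
  have hint : ∀ s t k k', Integrable (fun x => Φ s k x * Φ t k' x) Pπ := fun s t k k' =>
    integrable_of_bounded _ ((hΦm s k).mul (hΦm t k'))
      (C := (C * C + |autocov κ π g s|) * (C * C + |autocov κ π g t|)) fun x => by
        rw [abs_mul]
        exact mul_le_mul (hΦb s k x) (hΦb t k' x) (abs_nonneg _) ((abs_nonneg _).trans (hΦb s k x))
  set d : Fin (W + 1) → Fin (W + 1) → ℝ := fun s t => ∫ x, Φ s 0 x * Φ t 0 x ∂Pπ with hd
  set c : Fin (W + 1) → Fin (W + 1) → ℕ → ℝ := fun s t k => ∫ x, Φ s 0 x * Φ t (k + 1) x ∂Pπ with hc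
  have hsum : ∀ s t, Summable (c s t) := fun s t => by
    simp only [hc, hΦ, hPπ]
    exact summable_chainLagCov_of_nHit κ W hπ hε hmin hm hg hC s t
  -- the left-hand side
  have hL : ∑ s : Fin (W + 1), ∑ t : Fin (W + 1), a s * a t * chainLagACov κ π g W s t
      = ∑ s : Fin (W + 1), ∑ t : Fin (W + 1), a s * a t * d s t
        + 2 * ∑ s : Fin (W + 1), ∑ t : Fin (W + 1), a s * a t * ∑' k, c s t k := by
    have h1 : ∀ s t, chainLagACov κ π g W s t = d s t + ((∑' k, c s t k) + ∑' k, c t s k) := fun s t => by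
      rw [← Summable.tsum_add (hsum s t) (hsum t s)]
      rfl
    simp_rw [h1, mul_add, sum_add_distrib]
    have h2 : ∑ s : Fin (W + 1), ∑ t : Fin (W + 1), a s * a t * ∑' k, c t s k
        = ∑ s : Fin (W + 1), ∑ t : Fin (W + 1), a s * a t * ∑' k, c s t k := by
      rw [sum_comm]
      exact sum_congr rfl fun s _ => sum_congr rfl fun t _ => by rw [mul_comm (a t) (a s)]
    rw [h2]
    ring
  -- the right-hand side
  have hψ : ∀ (k : ℕ) (x : ℕ → S), lagProdComb g W a (windowPath W x k) - ∑ t : Fin (W + 1), a t * autocov κ π g t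
      = ∑ t : Fin (W + 1), a t * Φ t k x := fun k x => by
    simp only [lagProdComb, hΦ, mul_sub, sum_sub_distrib]
  have hprod : ∀ (k k' : ℕ) (x : ℕ → S),
      (∑ s : Fin (W + 1), a s * Φ s k x) * (∑ t : Fin (W + 1), a t * Φ t k' x)
        = ∑ s : Fin (W + 1), ∑ t : Fin (W + 1), a s * a t * (Φ s k x * Φ t k' x) := fun k k' x => by
    rw [sum_mul_sum]
    exact sum_congr rfl fun s _ => sum_congr rfl fun t _ => mul_mul_mul_comm _ _ _ _
  have hI : ∀ k k' : ℕ, ∫ x, ∑ s : Fin (W + 1), ∑ t : Fin (W + 1), a s * a t * (Φ s k x * Φ t k' x) ∂Pπ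
      = ∑ s : Fin (W + 1), ∑ t : Fin (W + 1), a s * a t * ∫ x, Φ s k x * Φ t k' x ∂Pπ := fun k k' => by
    rw [integral_finsetSum _ (fun s _ => integrable_finsetSum _ (fun t _ => (hint s t k k').const_mul _))]
    refine sum_congr rfl fun s _ => ?_
    rw [integral_finsetSum _ (fun t _ => (hint s t k k').const_mul _)]
    refine sum_congr rfl fun t _ => ?_
    exact integral_const_mul _ _
  have hR : windowLRVar κ π W (lagProdComb g W a)
      = ∑ s : Fin (W + 1), ∑ t : Fin (W + 1), a s * a t * d s t
        + 2 * ∑ s : Fin (W + 1), ∑ t : Fin (W + 1), a s * a t * ∑' k, c s t k := by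
    rw [windowLRVar_eq, ← hPπ, hPπ, integral_lagProdComb_window_zero κ hπ hg hC W a, ← hPπ]
    simp_rw [hψ, sq, hprod, hI]
    congr 1
    congr 1
    rw [Summable.tsum_finsetSum (fun s _ => summable_sum (fun t _ => (hsum s t).mul_left _))]
    refine sum_congr rfl fun s _ => ?_
    rw [Summable.tsum_finsetSum (fun t _ => (hsum s t).mul_left _)]
    refine sum_congr rfl fun t _ => ?_
    exact tsum_mul_left
  rw [hL, hR]

/-! ## Nonnegativity -/

/-- **`0 ≤ windowLRVar κ π W ψ`** for every bounded measurable window functional `ψ` under a Doeblin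
power: the Green–Kubo variance of the window chain is `∫ h² dπ_W − ∫ (κ_W h)² dπ_W ≥ 0` for a bounded
Poisson solution `h` (row 13's `integral_sq_sub_sq_kop_eq_greenKubo_of_nHit` and Jensen). -/
theorem windowLRVar_nonneg_of_nHit (hπ : Kernel.Invariant κ π) (hε : ε ≠ 0)
    (hmin : ∀ z, ε • ν ≤ nHit κ m z) (hm : 0 < m) {ψ : (Fin (W + 1) → S) → ℝ} (hψ : Measurable ψ)
    {C : ℝ} (hC : ∀ v, |ψ v| ≤ C) : 0 ≤ windowLRVar κ π W ψ := by
  set Pπ := Kernel.trajMeasure (X := fun _ : ℕ => S) π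
    (fun n : ℕ => κ.comap (fun hh : (i : ↥(Finset.Iic n)) → S => hh ⟨n, Finset.mem_Iic.2 le_rfl⟩)
      (measurable_pi_apply _)) with hPπ
  set πW := Pπ.map (fun x : ℕ → S => windowPath W x 0) with hπWdef
  haveI hπWp : IsProbabilityMeasure πW :=
    Measure.isProbabilityMeasure_map (measurable_windowPath_at 0).aemeasurable
  haveI hνWp : IsProbabilityMeasure ((Kernel.trajMeasure (X := fun _ : ℕ => S) ν
      (fun n : ℕ => κ.comap (fun hh : (i : ↥(Finset.Iic n)) → S => hh ⟨n, Finset.mem_Iic.2 le_rfl⟩)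
        (measurable_pi_apply _))).map (fun x : ℕ → S => windowPath W x 0)) :=
    Measure.isProbabilityMeasure_map (measurable_windowPath_at 0).aemeasurable
  haveI := isMarkovKernel_nHit κ m
  haveI : Nonempty S := nonempty_of_isProbabilityMeasure π
  have hε0 : 0 < ε := pos_iff_ne_zero.2 hε
  have hε1 : ε ≤ 1 := eps_le_one_of_minorised hmin
  have hπW : Kernel.Invariant (windowKernel κ W) πW := by
    rw [hπWdef, hPπ]; exact invariant_windowKernel κ W hπ
  have hminWS : ∀ y {B : Set (Fin (W + 1) → S)}, MeasurableSet B →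
      ε * ((Kernel.trajMeasure (X := fun _ : ℕ => S) ν
        (fun n : ℕ => κ.comap (fun hh : (i : ↥(Finset.Iic n)) → S => hh ⟨n, Finset.mem_Iic.2 le_rfl⟩)
          (measurable_pi_apply _))).map (fun x : ℕ → S => windowPath W x 0)) B
        ≤ nHit (windowKernel κ W) (m + W) y B :=
    fun y _ hB => minorised_setwise (windowKernel_minorised_of_nHit κ W hmin) y hB
  -- the centred functional and its Poisson solution for the window chain
  set cψ := ∫ y, ψ y ∂πW with hcψ
  have hψbm : Measurable fun y => ψ y - cψ := hψ.sub measurable_const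
  have hψbC : ∀ y, |ψ y - cψ| ≤ C + |cψ| := fun y => (abs_sub _ _).trans (add_le_add (hC y) le_rfl)
  have hψb0 : ∫ y, (ψ y - cψ) ∂πW = 0 := by
    rw [integral_sub (integrable_of_bounded _ hψ hC) (integrable_const _), integral_const, probReal_univ,
      one_smul, hcψ, sub_self]
  obtain ⟨h, hhm, hhb, hpois⟩ := poisson_exists_of_nHit hminWS hε0 hε1 (by omega) hπW hψbm hψbC hψb0
  have hGK := integral_sq_sub_sq_kop_eq_greenKubo_of_nHit hminWS hε0 hε1 (by omega) hπW hψbm hψbC hψb0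
    hhm hhb hpois
  -- `windowLRVar = ∫ h² − ∫ (κ_W h)²`
  have hEq : windowLRVar κ π W ψ = ∫ y, h y ^ 2 ∂πW - ∫ y, (kop (windowKernel κ W) h y) ^ 2 ∂πW := by
    rw [hGK, windowLRVar_eq_greenKubo κ W hπ hψ hC]
    rfl
  rw [hEq, sub_nonneg]
  -- Jensen: `(κ_W h)² ≤ κ_W (h²)` pointwise, and `∫ κ_W (h²) dπ_W = ∫ h² dπ_W`
  have hh2m : Measurable fun y => h y ^ 2 := hhm.pow_const 2
  have hh2b : ∀ y, |h y ^ 2| ≤ (2 * (C + |cψ|) * (m + W : ℕ) / ε.toReal) ^ 2 := fun y => by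
    rw [abs_pow]
    exact pow_le_pow_left₀ (abs_nonneg _) (hhb y) 2
  calc ∫ y, (kop (windowKernel κ W) h y) ^ 2 ∂πW
      ≤ ∫ y, kop (windowKernel κ W) (fun z => h z ^ 2) y ∂πW := by
        refine integral_mono ?_ ?_ fun y => ?_
        · obtain ⟨hkm, hkb⟩ := iterate_kop_bounded_measurable (windowKernel κ W) hhm hhb 1
          exact integrable_of_bounded _ (hkm.pow_const 2) fun y => by
            rw [abs_pow]; exact pow_le_pow_left₀ (abs_nonneg _) (hkb y) 2
        · exact integrable_of_bounded _ (measurable_kop _ hh2m) (abs_kop_le _ hh2b)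
        · exact sq_integral_le_integral_sq (windowKernel κ W y) hhm hhb
    _ = ∫ y, h y ^ 2 ∂πW := integral_kop (windowKernel κ W) hπW hh2m hh2b

/-- Hence **the quadratic form of `Σ` is nonnegative**: `0 ≤ Σ_s Σ_t a_s a_t Σ(s,t)`. -/
theorem quadForm_chainLagACov_nonneg_of_nHit (hπ : Kernel.Invariant κ π) (hε : ε ≠ 0)
    (hmin : ∀ z, ε • ν ≤ nHit κ m z) (hm : 0 < m) {g : S → ℝ} (hg : Measurable g) {C : ℝ}
    (hC : ∀ z, |g z| ≤ C) (a : EuclideanSpace ℝ (Fin (W + 1))) :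
    0 ≤ ∑ s : Fin (W + 1), ∑ t : Fin (W + 1), a s * a t * chainLagACov κ π g W s t := by
  rw [quadForm_chainLagACov_of_nHit κ W hπ hε hmin hm hg hC a]
  exact windowLRVar_nonneg_of_nHit κ W hπ hε hmin hm (measurable_lagProdComb hg W a)
    (abs_lagProdComb_le hC W a)

end Doeblin

end Summit.Ventures.LatticeQCDFlow.Scoring

end
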